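import Mathlib
import Summits.Ventures.HodgeRepro.KubotaRank

/-!
# Kubota's character formula for the rank of a CM type (abelian Galois group)

Blind re-derivation cell `pub-hodge-repro`, seat `typer-2`.  Mathlib only (+ the cell's `CMType.lean`,
`HodgeSets.lean`, `CMRank.lean`, `Hecke.lean`, `MTLattice.lean`, `KubotaRank.lean`).

Printed statement (Kubota 1965, Lemma 2, p. 119, as quoted in the cell's `LitRank.lean`; Mai 1989 p. 194):
> "In the case where `G` is Abelian, Kubota has expressed the rank of `(K, S)` in terms of characters:
> `rank(K, S) = 1 + #{irreducible character χ of G : χ(ρ) = −1 and ∑_{s ∈ S} χ(s) ≠ 0}`."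

Here it is proved for the rank `cmRank S` of `CMRank.lean` (the rank of the type matrix, equal to
`dim_ℚ ℚ[G]·S`, `MTLattice.lean`, and to Kubota's field-theoretic rank, `KubotaRank.lean`), for a finite
abelian group `G` with a central involution `c` and a CM type `S` (`IsCMType c S`), with the characters
`ψ : AddChar (Additive G) ℂ` of Mathlib's finite-abelian Fourier theory (`AddChar.complexBasis`:
the characters form a basis of `G → ℂ`).

Proof.  `cmRank S = rank (R_S)` where `R_S` is the matrix of right multiplication by `S` on `ℚ[G]`
(`cmRank_eq_rank_leftMulMatrix`, `rank_rightMulMatrix`); the rank does not change under `ℚ ⊂ ℂ`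
(`rank_map_of_field`, via the rank normal form); over `ℂ` every character `ψ` is an eigenvector of `R_S`
with eigenvalue `∑_{s ∈ S} ψ(s)⁻¹` (`rightMulMatrixC_mulVec_chiFun`), and the characters form a basis, so
the rank is the number of characters with non-zero eigenvalue (`rank_eq_card_of_eigenbasis`); replacing
`ψ` by `ψ⁻¹` gives `#{ψ : ∑_{s∈S} ψ(s) ≠ 0}` (`cmRank_eq_card_charSum_ne_zero`, Kubota's formula for an
arbitrary subset); finally, for a CM type, an even non-trivial character has `∑_S ψ = 0` (because
`S ⊔ cS = G` and `∑_G ψ = 0`), the trivial character has `∑_S ψ = |S| ≠ 0`, and every character is even or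
odd (`cmRank_eq_one_add_card_odd`).
-/

open Finset Matrix MonoidAlgebra
open scoped Pointwise

namespace HodgeRepro.Hecke

/-! ### Rank is invariant under extension of scalars -/

section RankMap

variable {K L : Type*} [Field K] [Field L]

/-- `{i : α ⊕ β // i.isLeft}` is in bijection with `α`. -/
def subtypeIsLeftEquiv (α β : Type*) : {i : α ⊕ β // i.isLeft = true} ≃ α where
  toFun i := match i with
    | ⟨Sum.inl a, _⟩ => a
    | ⟨Sum.inr _, h⟩ => absurd h (by simp)
  invFun a := ⟨Sum.inl a, rfl⟩
  left_inv := by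
    rintro ⟨(a | b), h⟩
    · rfl
    · simp at h
  right_inv a := rfl

/-- The number of left summands. -/
theorem card_subtype_isLeft (α β : Type*) [Fintype α] [Fintype β] :
    Fintype.card {i : α ⊕ β // i.isLeft = true} = Fintype.card α :=
  Fintype.card_congr (subtypeIsLeftEquiv α β)

/-- The rank of the block matrix `fromBlocks 1 0 0 0` is the size of the identity block. -/
theorem rank_fromBlocks_one_zero (r s : ℕ) :
    (Matrix.fromBlocks (1 : Matrix (Fin r) (Fin r) K) 0 0 (0 : Matrix (Fin s) (Fin s) K)).rank = r := by
  classical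
  rw [← Matrix.diagonal_one, ← Matrix.diagonal_zero, Matrix.fromBlocks_diagonal, Matrix.rank_diagonal]
  have h : (fun i : Fin r ⊕ Fin s => Sum.elim (fun _ : Fin r => (1 : K)) (fun _ : Fin s => (0 : K)) i ≠ 0) =
      fun i => i.isLeft = true := by
    funext i
    cases i <;> simp
  simp only [h]
  rw [card_subtype_isLeft, Fintype.card_fin]

/-- **Rank is invariant under extension of the field of scalars**: for a ring homomorphism of fields
`f : K →+* L`, `rank (A.map f) = rank A`. -/
theorem rank_map_of_field (f : K →+* L) {m : Type*} [Fintype m] [DecidableEq m] (A : Matrix m m K) :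
    (A.map f).rank = A.rank := by
  classical
  obtain ⟨V, U, e, hV, hU, hVMU⟩ := Matrix.exists_rank_normal_form A
  have hmap : (V.map f) * (A.map f) * (U.map f) =
      (Matrix.fromBlocks (1 : Matrix (Fin A.rank) (Fin A.rank) L) 0 0
        (0 : Matrix (Fin (Fintype.card m - A.rank)) (Fin (Fintype.card m - A.rank)) L)).submatrix e e := by
    rw [← Matrix.map_mul, ← Matrix.map_mul, hVMU, ← Matrix.submatrix_map, Matrix.fromBlocks_map,
      Matrix.map_one f f.map_zero f.map_one, Matrix.map_zero f f.map_zero,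
      Matrix.map_zero f f.map_zero, Matrix.map_zero f f.map_zero]
  have hVdet : IsUnit (V.map f).det := by
    have : (V.map f).det = f V.det := (RingHom.map_det f V).symm
    rw [this]
    exact (hV.map (Matrix.detMonoidHom)).map f
  have hUdet : IsUnit (U.map f).det := by
    have : (U.map f).det = f U.det := (RingHom.map_det f U).symm
    rw [this]
    exact (hU.map (Matrix.detMonoidHom)).map f
  have h1 : ((V.map f) * (A.map f) * (U.map f)).rank = (A.map f).rank := by
    rw [Matrix.rank_mul_eq_left_of_isUnit_det _ _ hUdet, Matrix.rank_mul_eq_right_of_isUnit_det _ _ hVdet]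
  rw [← h1, hmap, Matrix.rank_submatrix, rank_fromBlocks_one_zero]

end RankMap

/-! ### The rank of a matrix with an eigenbasis -/

section Eigen

variable {L : Type*} [Field L] [DecidableEq L] {n ι : Type*} [Fintype n] [DecidableEq n] [Fintype ι]
  [DecidableEq ι]

omit [DecidableEq n] in
/-- If a basis `B` consists of eigenvectors of `A` (`A *ᵥ B i = μ i • B i`), then
`rank A = #{i | μ i ≠ 0}`. -/
theorem rank_eq_card_of_eigenbasis (A : Matrix n n L) (B : Module.Basis ι L (n → L)) (μ : ι → L)
    (h : ∀ i, A *ᵥ B i = μ i • B i) : A.rank = Fintype.card {i // μ i ≠ 0} := by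
  classical
  have hD : LinearMap.toMatrix B B A.mulVecLin = Matrix.diagonal μ := by
    ext i j
    rw [LinearMap.toMatrix_apply, Matrix.mulVecLin_apply, h j, map_smul, Module.Basis.repr_self,
      Matrix.diagonal_apply, Finsupp.smul_apply, Finsupp.single_apply, smul_eq_mul]
    by_cases hij : i = j
    · subst hij; simp
    · simp [hij, Ne.symm hij]
  have h1 : (Matrix.diagonal μ).rank = A.rank := by
    rw [← hD, Matrix.rank_eq_finrank_range_toLin (LinearMap.toMatrix B B A.mulVecLin) B B,
      Matrix.toLin_toMatrix]
    rfl
  rw [← h1, Matrix.rank_diagonal]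

end Eigen

/-! ### Characters of a finite abelian group as eigenvectors of right multiplication -/

variable {G : Type*} [CommGroup G] [Fintype G] [DecidableEq G]

/-- The complexified matrix of right multiplication by `x ∈ ℚ[G]`. -/
noncomputable def rightMulMatrixC (x : MonoidAlgebra ℚ G) : Matrix G G ℂ :=
  (rightMulMatrix x).map (algebraMap ℚ ℂ)

/-- Complexification does not change the rank. -/
theorem rank_rightMulMatrixC (x : MonoidAlgebra ℚ G) :
    (rightMulMatrixC x).rank = (rightMulMatrix x).rank :=
  rank_map_of_field _ _

omit [Fintype G] in
/-- The entries of the complexified right-multiplication matrix of a subset are `0`/`1`. -/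
theorem rightMulMatrixC_qTypeOf_apply (S : Finset G) (k h : G) :
    rightMulMatrixC (qTypeOf S) k h = if h⁻¹ * k ∈ S then 1 else 0 := by
  unfold rightMulMatrixC
  rw [Matrix.map_apply, rightMulMatrix_apply, coeff_qTypeOf]
  split_ifs <;> simp

/-- A character of `G`, read as a function `G → ℂ`. -/
def chiFun (ψ : AddChar (Additive G) ℂ) : G → ℂ := fun g => ψ (Additive.ofMul g)

omit [Fintype G] [DecidableEq G] in
/-- `chiFun ψ g = ψ g`. -/
@[simp] theorem chiFun_apply (ψ : AddChar (Additive G) ℂ) (g : G) : chiFun ψ g = ψ (Additive.ofMul g) := rfl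

omit [Fintype G] [DecidableEq G] in
/-- A character is multiplicative. -/
theorem chiFun_mul (ψ : AddChar (Additive G) ℂ) (g h : G) : chiFun ψ (g * h) = chiFun ψ g * chiFun ψ h := by
  simp only [chiFun_apply, ofMul_mul, AddChar.map_add_eq_mul]

omit [Fintype G] [DecidableEq G] in
/-- A character maps inverses to inverses. -/
theorem chiFun_inv (ψ : AddChar (Additive G) ℂ) (g : G) : chiFun ψ g⁻¹ = (chiFun ψ g)⁻¹ := by
  simp only [chiFun_apply, ofMul_inv, AddChar.map_neg_eq_inv]

/-- The character sum `∑_{s ∈ S} ψ(s)`. -/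
noncomputable def charSum (S : Finset G) (ψ : AddChar (Additive G) ℂ) : ℂ := ∑ s ∈ S, chiFun ψ s

/-- The eigenvalue of right multiplication by `S` on the character `ψ`: `∑_{s ∈ S} ψ(s)⁻¹`. -/
noncomputable def charSumInv (S : Finset G) (ψ : AddChar (Additive G) ℂ) : ℂ := ∑ s ∈ S, (chiFun ψ s)⁻¹

omit [Fintype G] [DecidableEq G] in
/-- The eigenvalue of `ψ` is the character sum of `ψ⁻¹`. -/
theorem charSumInv_eq_charSum_inv (S : Finset G) (ψ : AddChar (Additive G) ℂ) :
    charSumInv S ψ = charSum S ψ⁻¹ := by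
  unfold charSumInv charSum
  refine Finset.sum_congr rfl fun s _ => ?_
  rw [chiFun_apply, chiFun_apply, AddChar.inv_apply']

/-- **Characters are eigenvectors** of right multiplication by `S`:
`R_S ψ = (∑_{s ∈ S} ψ(s)⁻¹) ψ`. -/
theorem rightMulMatrixC_mulVec_chiFun (S : Finset G) (ψ : AddChar (Additive G) ℂ) :
    rightMulMatrixC (qTypeOf S) *ᵥ chiFun ψ = charSumInv S ψ • chiFun ψ := by
  funext k
  rw [Matrix.mulVec, dotProduct, Pi.smul_apply, smul_eq_mul]
  -- reindex `h ↦ s = h⁻¹ k`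
  have e : G ≃ G := (Equiv.inv G).trans (Equiv.mulRight k)
  calc ∑ h, rightMulMatrixC (qTypeOf S) k h * chiFun ψ h
      = ∑ h, (if h⁻¹ * k ∈ S then 1 else 0) * chiFun ψ h := by
        simp only [rightMulMatrixC_qTypeOf_apply]
    _ = ∑ s, (if s ∈ S then 1 else 0) * chiFun ψ (k * s⁻¹) := by
        refine Fintype.sum_equiv ((Equiv.inv G).trans (Equiv.mulRight k)) _ _ fun h => ?_
        simp only [Equiv.trans_apply, Equiv.inv_apply, Equiv.coe_mulRight]
        congr 2
        group
    _ = ∑ s ∈ S, chiFun ψ (k * s⁻¹) := by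
        simp only [ite_mul, one_mul, zero_mul, Finset.sum_ite_mem, Finset.univ_inter]
    _ = charSumInv S ψ * chiFun ψ k := by
        unfold charSumInv
        rw [Finset.sum_mul]
        refine Finset.sum_congr rfl fun s _ => ?_
        rw [chiFun_mul, chiFun_inv, mul_comm]

/-- The characters of `G` as a basis of `G → ℂ` (Mathlib's `AddChar.complexBasis`). -/
noncomputable def charBasis : Module.Basis (AddChar (Additive G) ℂ) ℂ (G → ℂ) :=
  AddChar.complexBasis (Additive G)

omit [DecidableEq G] in
/-- The basis vector of `ψ` is `ψ` itself, as a function `G → ℂ`. -/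
theorem charBasis_apply (ψ : AddChar (Additive G) ℂ) : charBasis ψ = chiFun ψ := by
  show AddChar.complexBasis (Additive G) ψ = chiFun ψ
  exact AddChar.complexBasis_apply ψ

open scoped Classical in
/-- **Kubota's formula for an arbitrary subset**: `cmRank S = #{ψ : ∑_{s ∈ S} ψ(s)⁻¹ ≠ 0}`. -/
theorem cmRank_eq_card_charSumInv_ne_zero (S : Finset G) :
    cmRank S = Fintype.card {ψ : AddChar (Additive G) ℂ // charSumInv S ψ ≠ 0} := by
  rw [cmRank_eq_rank_leftMulMatrix, ← rank_rightMulMatrix, ← rank_rightMulMatrixC]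
  refine rank_eq_card_of_eigenbasis _ charBasis (charSumInv S) fun ψ => ?_
  rw [charBasis_apply]
  exact rightMulMatrixC_mulVec_chiFun S ψ

open scoped Classical in
/-- **Kubota's formula for an arbitrary subset**, with the plain character sums:
`cmRank S = #{ψ : ∑_{s ∈ S} ψ(s) ≠ 0}`. -/
theorem cmRank_eq_card_charSum_ne_zero (S : Finset G) :
    cmRank S = Fintype.card {ψ : AddChar (Additive G) ℂ // charSum S ψ ≠ 0} := by
  rw [cmRank_eq_card_charSumInv_ne_zero]
  refine Fintype.card_congr (Equiv.subtypeEquiv (Equiv.inv (AddChar (Additive G) ℂ)) fun ψ => ?_)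
  rw [Equiv.inv_apply, charSumInv_eq_charSum_inv]

/-! ### The CM refinement: even characters drop out -/

omit [DecidableEq G] in
/-- The full character sum `∑_{g ∈ G} ψ(g)` vanishes for a non-trivial character. -/
theorem charSum_univ_eq_zero {ψ : AddChar (Additive G) ℂ} (hψ : ψ ≠ 0) : charSum (univ : Finset G) ψ = 0 := by
  unfold charSum
  have h := AddChar.sum_eq_zero_iff_ne_zero.2 hψ
  rw [← h]
  exact Fintype.sum_equiv Additive.ofMul _ _ fun g => rfl

omit [Fintype G] [DecidableEq G] in
/-- `ψ(c) = ±1` for an involution `c`. -/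
theorem chiFun_conj_eq_one_or_neg_one {c : G} (hc : IsComplexConj c) (ψ : AddChar (Additive G) ℂ) :
    chiFun ψ c = 1 ∨ chiFun ψ c = -1 := by
  have h : chiFun ψ c * chiFun ψ c = 1 := by
    rw [← chiFun_mul, hc.mul_self, chiFun_apply, ofMul_one, AddChar.map_zero_eq_one]
  exact mul_self_eq_one_iff.1 h

/-- For a CM type `S` and an even character (`ψ(c) = 1`) which is not trivial, `∑_{s ∈ S} ψ(s) = 0`:
indeed `∑_G ψ = ∑_S ψ + ∑_{cS} ψ = (1 + ψ(c)) ∑_S ψ` and `∑_G ψ = 0`. -/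
theorem charSum_eq_zero_of_even {c : G} {S : Finset G} (hc : IsComplexConj c) (hS : IsCMType c S)
    {ψ : AddChar (Additive G) ℂ} (hψ : ψ ≠ 0) (heven : chiFun ψ c = 1) : charSum S ψ = 0 := by
  have hsmul : charSum (c • S) ψ = chiFun ψ c * charSum S ψ := by
    unfold charSum
    rw [Finset.mul_sum, smul_finset_def, Finset.sum_image (fun x _ y _ hxy => smul_left_cancel c hxy)]
    refine Finset.sum_congr rfl fun s _ => ?_
    rw [smul_eq_mul, chiFun_mul]
  have huniv : charSum (univ : Finset G) ψ = charSum S ψ + charSum (c • S) ψ := by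
    unfold charSum
    rw [hS.smul_eq_compl hc, Finset.sum_add_sum_compl]
  have h0 := charSum_univ_eq_zero hψ
  rw [huniv, hsmul, heven, one_mul] at h0
  have h2 : (2 : ℂ) * charSum S ψ = 0 := by rw [two_mul]; exact h0
  exact (mul_eq_zero.1 h2).resolve_left two_ne_zero

omit [Fintype G] [DecidableEq G] in
/-- The trivial character has `∑_{s ∈ S} ψ(s) = |S|`. -/
theorem charSum_zero (S : Finset G) : charSum S (0 : AddChar (Additive G) ℂ) = S.card := by
  unfold charSum
  simp [chiFun]

open scoped Classical in
/-- **Kubota's character formula** (Kubota 1965, Lemma 2; Mai 1989 p. 194): for a CM type `S` of a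
finite abelian group `G` with complex conjugation `c`,
`cmRank S = 1 + #{ψ : ψ(c) = −1 ∧ ∑_{s ∈ S} ψ(s) ≠ 0}`. -/
theorem cmRank_eq_one_add_card_odd {c : G} {S : Finset G} (hc : IsComplexConj c) (hS : IsCMType c S) :
    cmRank S = 1 + Fintype.card {ψ : AddChar (Additive G) ℂ // chiFun ψ c = -1 ∧ charSum S ψ ≠ 0} := by
  rw [cmRank_eq_card_charSum_ne_zero, Fintype.card_subtype, Fintype.card_subtype]
  have hsplit : (univ.filter fun ψ : AddChar (Additive G) ℂ => charSum S ψ ≠ 0) =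
      {(0 : AddChar (Additive G) ℂ)} ∪ univ.filter fun ψ => chiFun ψ c = -1 ∧ charSum S ψ ≠ 0 := by
    ext ψ
    simp only [Finset.mem_filter, Finset.mem_univ, true_and, Finset.mem_union, Finset.mem_singleton]
    constructor
    · intro h
      by_cases hψ : ψ = 0
      · exact Or.inl hψ
      · refine Or.inr ⟨?_, h⟩
        rcases chiFun_conj_eq_one_or_neg_one hc ψ with h1 | h1
        · exact absurd (charSum_eq_zero_of_even hc hS hψ h1) h
        · exact h1
    · rintro (rfl | ⟨_, h⟩)
      · rw [charSum_zero]
        exact_mod_cast Finset.card_ne_zero.2 (Finset.nonempty_iff_ne_empty.2 hS.ne_empty)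
      · exact h
  have hdisj : Disjoint {(0 : AddChar (Additive G) ℂ)}
      (univ.filter fun ψ => chiFun ψ c = -1 ∧ charSum S ψ ≠ 0) := by
    rw [Finset.disjoint_singleton_left, Finset.mem_filter]
    rintro ⟨_, h, _⟩
    have : chiFun (0 : AddChar (Additive G) ℂ) c = 1 := by simp [chiFun]
    rw [this] at h
    norm_num at h
  rw [hsplit, Finset.card_union_of_disjoint hdisj, Finset.card_singleton]

end HodgeRepro.Hecke
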